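import Literature.Geometry.Lorentzian.KerrDomainOfDependence
import Literature.Geometry.Lorentzian.KerrConvergence
import Summits.FinalStateConjecture.FinalStateConjecture.Theorems.EIHFluxBalanceInertialRecessionLorentz
import Summits.FinalStateConjecture.FinalStateConjecture.Theorems.ClusterCompletenessAdiabaticMultiKerrILEDPointwiseTerm

/-!
# Route ClusterCompleteness — crux `AdiabaticMultiKerrILED`, line `Sketch`: boosted horizon factor

Helper file for the crux `stmt-FinalStateConjecture-14310`
(`Summit.FinalStateConjecture.FinalStateConjecture.Theses.ClusterCompleteness.AdiabaticMultiKerrILED`),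
closing the stub `stub_horizonFactor` of line `Sketch`.

For one hole in inertial motion `(Λ, p)` with rest-frame coordinates `q x = Λ⁻¹(x − (0, p))` the
weight of the finite-time energy estimate contains the **receding horizon factor**
`x ↦ χ(u₂(q x)/ε − 1)`, `χ = Real.smoothTransition`, `u₂ = Kerr.horizonFn M a`. We prove: it is
`C¹` (`Kerr.contDiff_horizonFactor` composed with the affine `q`), nonzero only where
`r ∘ q > r₊`, equal to `1` where `u₂ ∘ q ≥ 2ε`, and — the substance — where the lab coefficient
field is exactly the boosted Kerr field `G(x) = η − 2H(z) (Λℓ♯(z)) ⊗ (Λℓ♯(z))`, `z = q x`, its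
differential pairs nonpositively with the lab `dt`-current `T^{μ0}[w]` (`KerrSchild.normalCurrent`).
This is the Lorentz-covariant form of `Kerr.horizonFactor_flux`, reduced to the same inputs:
`Kerr.horizonCovector_causal` (in the REST frame the conormal `ν = s dt* − dr`, `s = (r − r₊)/(2M)`,
is causal and co-oriented with `dt*`; `Δ ≤ r(r − r₊) ≤ 4Mrs` by `Kerr.delta_le_mul_sub_rPlus`;
`d(χ(u₂/ε − 1)) = −k ν`, `k ≥ 0`) and the dominant energy condition
`KerrSchild.Background.sum_mul_normalCurrent_nonneg`, applied to the CONSTANT generalised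
Kerr–Schild background `η − φ₀ l₀ ⊗ l₀ = G(x)` of `stub_pointwiseTerm` (the current at `x` sees only
`G(x)`). The frame transfer is `η`-bookkeeping: with `ν = η(N, ·)` the lab conormal (chain rule,
linear part `Λ⁻¹`) is `η(ΛN, ·)`; `∑ G^{μκ}ν_μν_κ = η(N, N) − 2H η(N, ℓ♯)²` is `Λ`-invariant, and
`∑ G^{0μ}ν_lab,μ = (ΛV)⁰ ≤ 0` for the past causal rest-frame vector `V = N − 2H η(N, ℓ♯) ℓ♯`
because `Λ` is orthochronous (`u⁰ > 0`; reverse Cauchy–Schwarz). Hawking–Ellis 1973, §4.3,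
Lemma 4.3.1; O'Neill 1983, Ch. 5, Lemma 5.26 and Ch. 9, pp. 233–236; Kerr–Schild 1965, §2.
[folklore]
-/

noncomputable section

-- the doubled `FinalStateConjecture.FinalStateConjecture` path component trips dupNamespace
set_option linter.dupNamespace false

open scoped InnerProductSpace
open Literature.Geometry.Lorentzian

namespace Summit.FinalStateConjecture.FinalStateConjecture.Cruxes.AdiabaticMultiKerrILED.Sketch

/-! ### Minkowski bookkeeping: covectors as `η`-duals of vectors -/

/-- `η(N, e₀) = −N⁰` (O'Neill 1983, Ch. 3, p. 55). [folklore] -/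
private theorem hf_bilin_basisVector_zero_right (N : E4) :
    Minkowski.bilin N (E4.basisVector 0) = -N 0 := by
  rw [Minkowski.bilin_symm, Minkowski.bilin_basisVector_zero_left]

/-- `η(N, e₁) = N¹` (O'Neill 1983, Ch. 3, p. 55). [folklore] -/
private theorem hf_bilin_basisVector_one_right (N : E4) :
    Minkowski.bilin N (E4.basisVector 1) = N 1 := by
  simp [Minkowski.bilin_apply, Fin.sum_univ_three]

/-- `η(N, e₂) = N²` (O'Neill 1983, Ch. 3, p. 55). [folklore] -/
private theorem hf_bilin_basisVector_two_right (N : E4) :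
    Minkowski.bilin N (E4.basisVector 2) = N 2 := by
  simp [Minkowski.bilin_apply, Fin.sum_univ_three]

/-- `η(N, e₃) = N³` (O'Neill 1983, Ch. 3, p. 55). [folklore] -/
private theorem hf_bilin_basisVector_three_right (N : E4) :
    Minkowski.bilin N (E4.basisVector 3) = N 3 := by
  simp [Minkowski.bilin_apply, Fin.sum_univ_three]

/-- `η(e_μ, e_ν) = η_{μν} = diag(−1, 1, 1, 1)` (O'Neill 1983, Ch. 3, p. 55). [folklore] -/
private theorem hf_bilin_basisVector_basisVector (μ ν : Fin 4) :
    Minkowski.bilin (E4.basisVector μ) (E4.basisVector ν) = Kerr.etaComp μ ν := by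
  rw [Kerr.etaComp]
  fin_cases μ <;> fin_cases ν <;> simp [Fin.sum_univ_three, Fin.succ_ne_zero]

/-- **Contraction of a generalised Kerr–Schild inverse metric with the `η`-dual covector of
`N`**: `∑_{μκ} (η_{μκ} − f l^μ l^κ) ν_μ ν_κ = η(N, N) − f η(N, l)²` for `ν_μ = η(N, e_μ)`
(Kerr–Schild 1965, §2). [folklore] -/
private theorem hf_sum_sum_ksContraction (f : ℝ) (l N : E4) :
    ∑ μ, ∑ κ, (Kerr.etaComp μ κ - f * l μ * l κ) * Minkowski.bilin N (E4.basisVector μ) *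
        Minkowski.bilin N (E4.basisVector κ) =
      Minkowski.bilin N N - f * Minkowski.bilin N l ^ 2 := by
  simp only [Fin.sum_univ_four, Kerr.etaComp, Fin.isValue, hf_bilin_basisVector_zero_right,
    hf_bilin_basisVector_one_right, hf_bilin_basisVector_two_right,
    hf_bilin_basisVector_three_right]
  simp only [show (1 : Fin 4) ≠ 0 from by decide, show (2 : Fin 4) ≠ 0 from by decide,
    show (3 : Fin 4) ≠ 0 from by decide, show (0 : Fin 4) ≠ 1 from by decide,
    show (0 : Fin 4) ≠ 2 from by decide, show (0 : Fin 4) ≠ 3 from by decide,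
    show (1 : Fin 4) ≠ 2 from by decide, show (1 : Fin 4) ≠ 3 from by decide,
    show (2 : Fin 4) ≠ 1 from by decide, show (2 : Fin 4) ≠ 3 from by decide,
    show (3 : Fin 4) ≠ 1 from by decide, show (3 : Fin 4) ≠ 2 from by decide, if_true, if_false]
  rw [Minkowski.bilin_apply N N, Minkowski.bilin_apply N l, Fin.sum_univ_three,
    Fin.sum_univ_three]
  simp only [Fin.isValue, Fin.succ_zero_eq_one, Fin.succ_one_eq_two]
  rw [show (2 : Fin 3).succ = (3 : Fin 4) from rfl]
  ring

/-- **The `dt`-row of the contraction**: `∑_μ (η_{0μ} − f l⁰ l^μ) ν_μ = N⁰ − f l⁰ η(N, l)`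
for `ν_μ = η(N, e_μ)` (Kerr–Schild 1965, §2). [folklore] -/
private theorem hf_sum_ksContraction_zero (f : ℝ) (l N : E4) :
    ∑ μ, (Kerr.etaComp 0 μ - f * l 0 * l μ) * Minkowski.bilin N (E4.basisVector μ) =
      N 0 - f * l 0 * Minkowski.bilin N l := by
  simp only [Fin.sum_univ_four, Kerr.etaComp, Fin.isValue, hf_bilin_basisVector_zero_right,
    hf_bilin_basisVector_one_right, hf_bilin_basisVector_two_right,
    hf_bilin_basisVector_three_right]
  simp only [show (0 : Fin 4) ≠ 1 from by decide,
    show (0 : Fin 4) ≠ 2 from by decide, show (0 : Fin 4) ≠ 3 from by decide, if_true, if_false]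
  rw [Minkowski.bilin_apply N l, Fin.sum_univ_three]
  simp only [Fin.isValue, Fin.succ_zero_eq_one, Fin.succ_one_eq_two]
  rw [show (2 : Fin 3).succ = (3 : Fin 4) from rfl]
  ring

/-- **An orthochronous Lorentz transformation preserves the past causal cone**: if
`(Λ e₀)⁰ > 0`, `η(V, V) ≤ 0` and `V⁰ ≤ 0`, then `(Λ V)⁰ ≤ 0`. Indeed
`(Λ V)⁰ = −η(Λ V, e₀) = −η(V, Λ⁻¹ e₀)` and `u' = Λ⁻¹ e₀` is future unit timelike
(`(Λ⁻¹e₀)⁰ = (Λe₀)⁰ > 0`), so the reverse Cauchy–Schwarz inequality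
`η(V, u') ≥ (−V⁰)(u'⁰ − |u'⃗|) ≥ 0` applies (O'Neill 1983, Ch. 5, Lemma 5.26 ff.; Ch. 9,
p. 233). [folklore] -/
private theorem hf_lorentz_apply_zero_nonpos (Λ : lorentzGroup)
    (hΛ : 0 < ((Λ : E4 ≃L[ℝ] E4) (E4.basisVector 0)) 0) {V : E4}
    (hVV : Minkowski.bilin V V ≤ 0) (hV0 : V 0 ≤ 0) : ((Λ : E4 ≃L[ℝ] E4) V) 0 ≤ 0 := by
  set u' : E4 := (Λ : E4 ≃L[ℝ] E4).symm (E4.basisVector 0) with hu'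
  have hu'0 : 0 < u' 0 := by
    rw [hu', Theorems.lorentz_symm_apply_basisVector_zero]; exact hΛ
  -- `(Λ V)⁰ = −η(V, u')`
  have h1 : ((Λ : E4 ≃L[ℝ] E4) V) 0 = -Minkowski.bilin V u' := by
    have h := Λ.2 V u'
    rw [hu', ContinuousLinearEquiv.apply_symm_apply, hf_bilin_basisVector_zero_right] at h
    rw [← hu'] at h
    linarith
  -- `u'` is unit timelike: `|u'⃗|² = (u'⁰)² − 1`
  have hu'u' : E4.spatialNorm u' ^ 2 = (u' 0) ^ 2 - 1 := by
    have h := Λ.2 u' u'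
    rw [hu', ContinuousLinearEquiv.apply_symm_apply, ← hu', Minkowski.bilin_basisVector_zero,
      Theorems.minkowski_bilin_self] at h
    linarith
  have hun : E4.spatialNorm u' ≤ u' 0 := by
    refine le_of_pow_le_pow_left₀ two_ne_zero hu'0.le ?_
    rw [hu'u']
    linarith
  -- `|V⃗| ≤ −V⁰`
  have hVn : E4.spatialNorm V ≤ -V 0 := by
    refine le_of_pow_le_pow_left₀ two_ne_zero (by linarith) ?_
    have h := Theorems.minkowski_bilin_self V
    nlinarith
  -- `η(V, u') = −V⁰u'⁰ + ⟪V⃗, u'⃗⟫ ≥ −V⁰u'⁰ − |V⃗||u'⃗| ≥ 0`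
  have hVu : Minkowski.bilin V u' = -(V 0 * u' 0) + ⟪E4.spatial V, E4.spatial u'⟫_ℝ := by
    rw [Minkowski.bilin_apply, PiLp.inner_apply]
    congr 1
    refine Finset.sum_congr rfl fun i _ => ?_
    simp [E4.spatial_apply, mul_comm]
  have hCS : |⟪E4.spatial V, E4.spatial u'⟫_ℝ| ≤ E4.spatialNorm V * E4.spatialNorm u' :=
    abs_real_inner_le_norm _ _
  have hlow : -(E4.spatialNorm V * E4.spatialNorm u') ≤ ⟪E4.spatial V, E4.spatial u'⟫_ℝ :=
    (abs_le.mp hCS).1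
  have hprod : E4.spatialNorm V * E4.spatialNorm u' ≤ (-V 0) * u' 0 :=
    mul_le_mul hVn hun (E4.spatialNorm_nonneg _) (by linarith)
  rw [h1, hVu]
  linarith

/-! ### The stub -/

/-- **The receding horizon factor of a boosted hole and the sign of its flux.** For `ε > 0` the
function `x ↦ χ(u₂(q x)/ε − 1)` (`u₂ = Kerr.horizonFn M a`, `χ = Real.smoothTransition`, `q` the
Poincaré map to the rest frame) is `C¹` on `ℝ⁴`, is nonzero only strictly outside the boosted
horizon, equals `1` where `u₂ ∘ q ≥ 2ε`, and — at exterior points where the coefficient field is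
exactly the boosted Kerr field `η − 2H (Λℓ♯)⊗(Λℓ♯)` — its differential has nonpositive pairing
with the lab `dt`-current `T^{μ0}[w]` of every `w`. Lorentz covariance of
`Kerr.horizonFactor_flux`: `d(χ(u₂∘q/ε − 1))(x) = −k η(ΛN, ·)` with `k ≥ 0` and
`η(N, ·) = s dt* − dr` the rest-frame conormal (`Kerr.horizonCovector_causal`: causal and
co-oriented, using `Kerr.delta_le_mul_sub_rPlus`); causality is `Λ`-invariant, co-orientation
transfers because `Λ` is orthochronous (`u⁰ > 0`), and the dominant energy condition
(`KerrSchild.Background.sum_mul_normalCurrent_nonneg`) is applied on the constant background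
`η − φ₀ l₀ ⊗ l₀ = G(x)` of `stub_pointwiseTerm`. Hawking–Ellis 1973, §4.3, Lemma 4.3.1;
O'Neill 1983, Ch. 9, pp. 233–236; Kerr–Schild 1965, §2. [folklore] -/
theorem stub_horizonFactor :
    ∀ (M a : ℝ) (Λ : lorentzGroup) (p : E3) (u : E4) (q : E4 → E4),
      u = (Λ : E4 ≃L[ℝ] E4) (E4.basisVector 0) → (∀ x, q x = poincareInv Λ (E4.ofTimeSpace 0 p) x) →
      0 < M → |a| ≤ 2⁻¹ * M → 0 < u 0 → ∀ ε : ℝ, 0 < ε →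
      (ContDiff ℝ 1 fun x ↦ Real.smoothTransition (Kerr.horizonFn M a (q x) / ε - 1)) ∧
      (∀ x, Real.smoothTransition (Kerr.horizonFn M a (q x) / ε - 1) ≠ 0 →
        Kerr.rPlus M a < Kerr.radius a (q x)) ∧
      (∀ x, 2 * ε ≤ Kerr.horizonFn M a (q x) →
        Real.smoothTransition (Kerr.horizonFn M a (q x) / ε - 1) = 1) ∧
      (∀ (G : E4 → Fin 4 → Fin 4 → ℝ) (w : E4 → ℝ) (x : E4),
        Kerr.rPlus M a < Kerr.radius a (q x) →
        (∀ μ ν, G x μ ν = Minkowski.bilin (E4.basisVector μ) (E4.basisVector ν) -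
          2 * Kerr.scalarH M a (q x) * ((Λ : E4 ≃L[ℝ] E4) (Kerr.nullVector a (q x))) μ *
            ((Λ : E4 ≃L[ℝ] E4) (Kerr.nullVector a (q x))) ν) →
        ∑ μ, fderiv ℝ (fun y ↦ Real.smoothTransition (Kerr.horizonFn M a (q y) / ε - 1)) x
            (E4.basisVector μ) * KerrSchild.normalCurrent G w x μ ≤ 0) := by
  intro M a Λ p u q hu hq hM ha hu0 ε hε
  -- substitute the defined quantities `u = Λ e₀`, `q = Λ⁻¹(· − (0, p))`
  have hq' : q = poincareInv Λ (E4.ofTimeSpace 0 p) := funext hq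
  subst hq' hu
  set c : E4 := E4.ofTimeSpace 0 p with hc
  -- basic parameter facts: `|a| ≤ M/2 < M`, so `r₊ > 0`
  have hMa : Kerr.IsSubextremal M a := by unfold Kerr.IsSubextremal; linarith
  have hrp : 0 < Kerr.rPlus M a := hMa.rPlus_pos
  have hqC : ∀ {n : WithTop ℕ∞}, ContDiff ℝ n (poincareInv Λ c) := fun {n} ↦
    (Λ : E4 ≃L[ℝ] E4).symm.contDiff.comp (contDiff_id.sub contDiff_const)
  refine ⟨?_, ?_, ?_, ?_⟩
  · -- (1) smoothness: the rest-frame factor is smooth, `q` is affine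
    exact (Kerr.contDiff_horizonFactor hrp hε).comp hqC
  · -- (2) support: `χ(σ) ≠ 0 ⇒ σ > 0 ⇒ u₂ > 0 ⇒ r > r₊`
    intro x hx
    by_contra hle
    rw [not_lt] at hle
    apply hx
    refine Real.smoothTransition.zero_of_nonpos ?_
    have h1 : Kerr.horizonFn M a (poincareInv Λ c x) ≤ 0 :=
      mul_nonpos_iff.mpr (Or.inr ⟨by linarith, (Real.exp_pos _).le⟩)
    have h2 : Kerr.horizonFn M a (poincareInv Λ c x) / ε ≤ 0 :=
      div_nonpos_iff.mpr (Or.inr ⟨h1, hε.le⟩)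
    linarith
  · -- (3) `u₂ ≥ 2ε ⇒ u₂/ε − 1 ≥ 1 ⇒ χ = 1`
    intro x hx
    refine Real.smoothTransition.one_of_one_le ?_
    rw [le_sub_iff_add_le, le_div_iff₀ hε]
    linarith
  · -- (4) the flux
    intro G w x hx hG
    -- ### the rest-frame point `z = q x` and the exterior facts
    set z : E4 := poincareInv Λ c x with hz
    have hzpos : 0 < Kerr.radius a z := hrp.trans hx
    have hH0 : 0 ≤ Kerr.scalarH M a z := Kerr.scalarH_nonneg hM.le a z
    have hℓℓ : Minkowski.bilin (Kerr.nullVector a z) (Kerr.nullVector a z) = 0 := by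
      rw [Kerr.bilin_nullVector, Kerr.nullCovector_nullVector hzpos]
    have hℓ0 : Kerr.nullVector a z 0 = -1 := Kerr.nullVector_apply_zero a z
    have hinv : ∀ v v' : E4, Minkowski.bilin ((Λ : E4 ≃L[ℝ] E4) v) ((Λ : E4 ≃L[ℝ] E4) v') =
        Minkowski.bilin v v' := fun v v' ↦ Λ.2 v v'
    -- ### one boosted term in normalised Kerr–Schild form at `z`: the constant background
    obtain ⟨Φ, -, hΦ⟩ := stub_pointwiseTerm M a Λ _ rfl hM ha hu0
    obtain ⟨φ₀, l₀, hφ₀, -, hnull, hnorm, hpt⟩ := hΦ z hx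
    let B₀ : KerrSchild.Background :=
      { φ := fun _ ↦ φ₀, l := fun _ ↦ l₀, bound := φ₀, φ_nonneg := fun _ ↦ hφ₀,
        φ_le := fun _ ↦ le_rfl, null := fun _ _ ↦ hnull, normalised := fun _ _ ↦ hnorm,
        contDiff_inverseMetric := fun μ ν ↦ by
          simp only [KerrSchild.inverseMetric]
          exact contDiff_const }
    have hB : ∀ μ κ, B₀.inverseMetric x μ κ = Kerr.etaComp μ κ -
        2 * Kerr.scalarH M a z * ((Λ : E4 ≃L[ℝ] E4) (Kerr.nullVector a z)) μ *
          ((Λ : E4 ≃L[ℝ] E4) (Kerr.nullVector a z)) κ := fun μ κ ↦ by rw [hpt μ κ]; rfl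
    have hGx : G x = B₀.inverseMetric x := by
      funext μ ν
      rw [hG μ ν, hB, hf_bilin_basisVector_basisVector]
    -- the current depends on the coefficients only through `G x`
    have hcur : ∀ μ, KerrSchild.normalCurrent G w x μ =
        KerrSchild.normalCurrent B₀.inverseMetric w x μ := fun μ ↦ by
      simp only [KerrSchild.normalCurrent, hGx]
    -- ### the rest-frame conormal `ν = s dt* − dr` as the `η`-dual of the vector `N`
    set s : ℝ := (2 * M)⁻¹ * (Kerr.radius a z - Kerr.rPlus M a) with hs
    have hs0 : 0 ≤ s := mul_nonneg (by positivity) (by linarith)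
    have hΔ : Kerr.radius a z ^ 2 - 2 * M * Kerr.radius a z + a ^ 2 ≤
        4 * M * Kerr.radius a z * s := by
      have h1 := Kerr.delta_le_mul_sub_rPlus hMa hx
      have h2 : 4 * M * Kerr.radius a z * s =
          2 * (Kerr.radius a z * (Kerr.radius a z - Kerr.rPlus M a)) := by
        rw [hs]; field_simp; ring
      rw [h2]
      nlinarith [mul_nonneg hzpos.le (sub_nonneg.mpr hx.le)]
    set N : E4 := E4.ofTimeSpace (-s) (-Kerr.radiusGradVec a (E4.spatial z)) with hN
    have hN0 : N 0 = -s := rfl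
    have hNs : ∀ i : Fin 3, N i.succ = -Kerr.radiusGradVec a (E4.spatial z) i := fun i ↦ by
      rw [hN, E4.ofTimeSpace_apply_succ, PiLp.neg_apply]
    have hb0 : Minkowski.bilin N (E4.basisVector 0) = s := by
      rw [hf_bilin_basisVector_zero_right, hN0, neg_neg]
    have hb1 : Minkowski.bilin N (E4.basisVector 1) = -Kerr.radiusGradVec a (E4.spatial z) 0 := by
      rw [hf_bilin_basisVector_one_right]; exact hNs 0
    have hb2 : Minkowski.bilin N (E4.basisVector 2) = -Kerr.radiusGradVec a (E4.spatial z) 1 := by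
      rw [hf_bilin_basisVector_two_right]; exact hNs 1
    have hb3 : Minkowski.bilin N (E4.basisVector 3) = -Kerr.radiusGradVec a (E4.spatial z) 2 := by
      rw [hf_bilin_basisVector_three_right]; exact hNs 2
    -- `η(N, v) = s v⁰ − dr(v⃗)`
    have hNv : ∀ v : E4, Minkowski.bilin N v =
        s * v 0 - Kerr.radiusGrad a (E4.spatial z) (E4.spatial v) := by
      intro v
      have h1 : Kerr.radiusGrad a (E4.spatial z) (E4.spatial v) =
          ∑ i : Fin 3, Kerr.radiusGradVec a (E4.spatial z) i * v i.succ := by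
        rw [Kerr.radiusGrad_apply, PiLp.inner_apply]
        refine Finset.sum_congr rfl fun i _ ↦ ?_
        simp [E4.spatial_apply, mul_comm]
      rw [h1, Minkowski.bilin_apply, Fin.sum_univ_three, Fin.sum_univ_three, hN0, hNs 0, hNs 1,
        hNs 2]
      ring
    -- ### the rest-frame conormal is causal and co-oriented with `dt*`
    obtain ⟨hcausal, horient⟩ :=
      Kerr.horizonCovector_causal (φ := fun _ ↦ 2 * Kerr.scalarH M a z) hM.le hzpos rfl hs0 hΔ
        (fun κ ↦ Minkowski.bilin N (E4.basisVector κ)) hb0 hb1 hb2 hb3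
    have hc_rest : Minkowski.bilin N N -
        2 * Kerr.scalarH M a z * Minkowski.bilin N (Kerr.nullVector a z) ^ 2 ≤ 0 := by
      have h := hcausal
      simp only [KerrSchild.inverseMetric] at h
      rwa [hf_sum_sum_ksContraction] at h
    have ho_rest :
        N 0 + 2 * Kerr.scalarH M a z * Minkowski.bilin N (Kerr.nullVector a z) ≤ 0 := by
      have h := horient
      simp only [KerrSchild.inverseMetric] at h
      rw [hf_sum_ksContraction_zero, hℓ0] at h
      linarith
    -- ### the lab conormal `ν_lab μ = η(ΛN, e_μ)` is causal and co-oriented for `G(x)`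
    have hc_lab : ∑ μ, ∑ κ, B₀.inverseMetric x μ κ *
        Minkowski.bilin ((Λ : E4 ≃L[ℝ] E4) N) (E4.basisVector μ) *
          Minkowski.bilin ((Λ : E4 ≃L[ℝ] E4) N) (E4.basisVector κ) ≤ 0 := by
      simp only [hB]
      rw [hf_sum_sum_ksContraction, hinv, hinv]
      exact hc_rest
    have ho_lab : ∑ μ, B₀.inverseMetric x 0 μ *
        Minkowski.bilin ((Λ : E4 ≃L[ℝ] E4) N) (E4.basisVector μ) ≤ 0 := by
      simp only [hB]
      rw [hf_sum_ksContraction_zero, hinv]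
      -- the rest-frame vector `V = g⁻¹(ν, ·)` is past causal, and `Λ` is orthochronous
      set V : E4 := N - (2 * Kerr.scalarH M a z * Minkowski.bilin N (Kerr.nullVector a z)) •
        Kerr.nullVector a z with hV
      have hV0 : V 0 ≤ 0 := by
        have : V 0 = N 0 + 2 * Kerr.scalarH M a z * Minkowski.bilin N (Kerr.nullVector a z) := by
          rw [hV, PiLp.sub_apply, PiLp.smul_apply, smul_eq_mul, hℓ0]
          ring
        rwa [this]
      have hVV : Minkowski.bilin V V ≤ 0 := by
        have : Minkowski.bilin V V = Minkowski.bilin N N -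
            4 * Kerr.scalarH M a z * Minkowski.bilin N (Kerr.nullVector a z) ^ 2 := by
          rw [hV]
          simp only [map_sub, map_smul, sub_apply, FunLike.coe_smul, Pi.smul_apply, smul_eq_mul,
            hℓℓ, Minkowski.bilin_symm (Kerr.nullVector a z) N]
          ring
        rw [this]
        nlinarith [mul_nonneg hH0 (sq_nonneg (Minkowski.bilin N (Kerr.nullVector a z)))]
      have hΛV := hf_lorentz_apply_zero_nonpos Λ hu0 hVV hV0
      have : ((Λ : E4 ≃L[ℝ] E4) V) 0 = ((Λ : E4 ≃L[ℝ] E4) N) 0 -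
          2 * Kerr.scalarH M a z * ((Λ : E4 ≃L[ℝ] E4) (Kerr.nullVector a z)) 0 *
            Minkowski.bilin N (Kerr.nullVector a z) := by
        rw [hV, map_sub, map_smul, PiLp.sub_apply, PiLp.smul_apply, smul_eq_mul]
        ring
      linarith
    -- ### the dominant energy condition on the constant background
    have hflux := B₀.sum_mul_normalCurrent_nonneg w x
      (fun μ ↦ Minkowski.bilin ((Λ : E4 ≃L[ℝ] E4) N) (E4.basisVector μ)) hc_lab ho_lab
    -- ### the derivative of the factor: `∂_μ(χ(u₂∘q/ε − 1))(x) = −k η(ΛN, e_μ)`, `k ≥ 0`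
    have hdiff : HasFDerivAt (Kerr.horizonFn M a) (fderiv ℝ (Kerr.horizonFn M a) z) z :=
      ((Kerr.contDiffAt_horizonFn M hzpos (n := 1)).differentiableAt (by simp)).hasFDerivAt
    have haff : HasDerivAt (fun t : ℝ ↦ t / ε - 1) (1 / ε) (Kerr.horizonFn M a z) :=
      ((hasDerivAt_id _).div_const ε).sub_const 1
    have hσ : ∀ t : ℝ, HasDerivAt Real.smoothTransition (deriv Real.smoothTransition t) t :=
      fun t ↦ ((Real.smoothTransition.contDiffAt (n := 1)).differentiableAt (by simp)).hasDerivAt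
    have hF : HasFDerivAt (fun y ↦ Real.smoothTransition (Kerr.horizonFn M a y / ε - 1))
        ((deriv Real.smoothTransition (Kerr.horizonFn M a z / ε - 1) * (1 / ε)) •
          fderiv ℝ (Kerr.horizonFn M a) z) z :=
      ((hσ _).comp _ haff).comp_hasFDerivAt z hdiff
    have hP : HasFDerivAt (poincareInv Λ c) ((Λ : E4 ≃L[ℝ] E4).symm : E4 →L[ℝ] E4) x := by
      have h : HasFDerivAt (fun y : E4 ↦ (Λ : E4 ≃L[ℝ] E4).symm (y - c))
          (((Λ : E4 ≃L[ℝ] E4).symm : E4 →L[ℝ] E4).comp (ContinuousLinearMap.id ℝ E4)) x :=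
        ((Λ : E4 ≃L[ℝ] E4).symm.hasFDerivAt).comp x ((hasFDerivAt_id x).sub_const c)
      rwa [ContinuousLinearMap.comp_id] at h
    have hd : HasFDerivAt
        (fun y ↦ Real.smoothTransition (Kerr.horizonFn M a (poincareInv Λ c y) / ε - 1))
        (((deriv Real.smoothTransition (Kerr.horizonFn M a z / ε - 1) * (1 / ε)) •
          fderiv ℝ (Kerr.horizonFn M a) z).comp ((Λ : E4 ≃L[ℝ] E4).symm : E4 →L[ℝ] E4)) x := by
      have h := hF.comp x hP; exact h
    set k : ℝ := deriv Real.smoothTransition (Kerr.horizonFn M a z / ε - 1) * (1 / ε) *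
      Real.exp (-((2 * M)⁻¹ * z 0)) with hk
    have hk0 : 0 ≤ k :=
      mul_nonneg (mul_nonneg Real.smoothTransition.monotone.deriv_nonneg (by positivity))
        (Real.exp_pos _).le
    have he : ∀ μ, fderiv ℝ
        (fun y ↦ Real.smoothTransition (Kerr.horizonFn M a (poincareInv Λ c y) / ε - 1)) x
          (E4.basisVector μ) =
        -(k * Minkowski.bilin ((Λ : E4 ≃L[ℝ] E4) N) (E4.basisVector μ)) := by
      intro μ
      have hv : Minkowski.bilin ((Λ : E4 ≃L[ℝ] E4) N) (E4.basisVector μ) =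
          Minkowski.bilin N ((Λ : E4 ≃L[ℝ] E4).symm (E4.basisVector μ)) := by
        rw [← hinv N, ContinuousLinearEquiv.apply_symm_apply]
      rw [hd.fderiv]
      simp only [ContinuousLinearMap.coe_comp, Function.comp_apply, FunLike.coe_smul,
        Pi.smul_apply, smul_eq_mul, ContinuousLinearEquiv.coe_coe]
      rw [Kerr.fderiv_horizonFn_apply hzpos, hv, hNv, hk, hs]
      ring
    -- ### conclusion: `∑_μ ∂_μ(factor) P^μ = −k ∑_μ ν_lab,μ P^μ ≤ 0`
    calc ∑ μ, fderiv ℝ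
          (fun y ↦ Real.smoothTransition (Kerr.horizonFn M a (poincareInv Λ c y) / ε - 1)) x
            (E4.basisVector μ) * KerrSchild.normalCurrent G w x μ
        = ∑ μ, -(k * Minkowski.bilin ((Λ : E4 ≃L[ℝ] E4) N) (E4.basisVector μ)) *
            KerrSchild.normalCurrent B₀.inverseMetric w x μ :=
          Finset.sum_congr rfl fun μ _ ↦ by rw [he μ, hcur μ]
      _ = -(k * ∑ μ, Minkowski.bilin ((Λ : E4 ≃L[ℝ] E4) N) (E4.basisVector μ) *
            KerrSchild.normalCurrent B₀.inverseMetric w x μ) := by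
          rw [Finset.mul_sum, ← Finset.sum_neg_distrib]
          exact Finset.sum_congr rfl fun μ _ ↦ by ring
      _ ≤ 0 := neg_nonpos.mpr (mul_nonneg hk0 hflux)

end Summit.FinalStateConjecture.FinalStateConjecture.Cruxes.AdiabaticMultiKerrILED.Sketch

end
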